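import Mathlib
import HarnessLib
import Summits.ResolutionOfSingularities.ResolutionOfSingularities.Theorems.HomologicalConductorNoZenoPrimeDivisorBasePt

/-!
# Route `HomologicalConductor`, crux `NoZeno`/`NoZenoR` (stmt-ResolutionOfSingularities-16483 / -19943),
# line `sandwich-cluster`, stub S2 `stub_regularOfBasePtsEmpty` — component (c):
# an exceptional prime divisor through a member of the quadratic sequence gives a base point

OURS (cell res-hironaka, crux chain W4.4, seat res-L0-w44-stub-3). Nothing here is a statement of the
manuscript under review (Hironaka 2017); AI-written, weaker than expert review.

The scheme-free plan for S2 (HOME `L/res-L0-w44-stub-3/S2-PLAN.md`): for a stage `T` with no base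
point over the regular `R`, follow the quadratic sequence `S_j` of `R` along the tower's valuation ring
`O` until `T ≤ S_N` (reach); by Zariski's Main Theorem (tree
`NormalBirationalQuasiFinite.bijective_algebraMap_of_essFiniteType_of_forall_isPrime`) either `T = S_N`
is regular, or `S_N` has a height-one prime `P` contracting to the closed point of `T`; THIS FILE shows
that the latter produces a base point of `T` over `R` — so `basePts R T = ∅` forces the former.

* `coe_eq_ordSet_of_isQuadraticTransformAlong_self` — **(E)**: if the quadratic transform of the
  regular local `S` ALONG a discrete valuation ring `W ⊇ S` dominating it is `W` itself, then
  `↑W = ordSet S` (`W = E_S`; the tail of `exists_coe_eq_ordSet_of_isDiscreteValuationRing`,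
  exported);
* `ringKrullDim_le_two_of_trdeg` — a `k`-subalgebra of `K` has dimension `≤ tr.deg_k K = 2`;
* **`basePts_nonempty_of_exceptional_divisor`** — `R` regular local of dimension two (`Frac R = K`,
  `tr.deg_k K = 2`), `O` a valuation ring dominating `R`, `S_j := quadraticSeq O R j`, `T ≤ S_N` with
  `S_N` two-dimensional and `T ⊄ S_j` (`j < N`); `W ⊇ S_N` a DVR of `K` dominating `R` and `T` but NOT
  `S_N` ⇒ `(basePts R T).Nonempty`.  Proof: `j₀ :=` the last index `≤ N` with `W` dominating `S_{j₀}`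
  (`Nat.findGreatest`; `0` qualifies, `N` does not); the `O`-chart `A = S_{j₀}[𝔪/u₀]` lies in
  `S_{j₀+1} ≤ S_N ≤ W`, so `u₀` has minimal `W`-value too and `Q := A_{𝔪_W ∩ A}` is the transform of
  `S_{j₀}` along `W`, regular, containing `S_{j₀+1} = A_{𝔪_O ∩ A}`; the centres satisfy
  `𝔮 := 𝔪_W ∩ A < 𝔫 := 𝔪_O ∩ A` (`≤` because `O`-units of `A` are `W`-units through `S_{j₀+1}`,
  `≠` because `W` does not dominate `S_{j₀+1}`), whence `dim Q = ht 𝔮 < ht 𝔫 ≤ dim A ≤ 2`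
  (`Ideal.height_add_one_le_of_lt_of_isPrime`, `IsLocalization.AtPrime.ringKrullDim_eq_height`);
  a regular local subring of dimension `≤ 1` dominated by `W` is `W`
  (`RuledResidues….eq_of_isRegularLocalRing_of_ringKrullDim_le_one`), so (E) gives
  `↑W = ordSet S_{j₀}` and `S_{j₀} ∈ basePts R T`.

Remaining for S2 (other files): (a) reach `T ≤ S_N` with `N` minimal and `S_N` two-dimensional (or the
DVR-stage exit, again by (E)); (b) the ZMT dichotomy; (d) assembly under the v10 binders.

References: O. Zariski, P. Samuel, *Commutative Algebra* II (1960), App. 5 [`ZariskiSamuel1960`];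
S. Abhyankar, Amer. J. Math. 78 (1956) [`Abhyankar1956Valuations`].
-/

noncomputable section

-- single-problem summit: the doubled namespace component `ResolutionOfSingularities` is forced
set_option linter.dupNamespace false

namespace Summit.ResolutionOfSingularities.ResolutionOfSingularities.Theorems.NoZeno.SandwichCluster

open IsLocalRing Literature.AlgebraicGeometry.Resolution
open Summit.ResolutionOfSingularities.ResolutionOfSingularities.Theorems

variable {k K : Type} [Field k] [Field K] [Algebra k K]

/-! ## (E) If the quadratic transform of `S` along the DVR `W` is `W` itself, then `W = E_S` -/

/-- **`W = E_S` when the transform of `S` along `W` is `W`.**  For a regular local `k`-subalgebra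
`S` of `K` (`Frac S = K`) dominated by a discrete valuation ring `W` of `K` whose quadratic transform
ALONG `W` is `W` itself (the quadratic sequence along `W` stops at `S`), `↑W = ordSet S`: `W` is the
order valuation ring (prime divisor `E_S`).  Proof: the transform datum gives `x ∈ 𝔪_S` of minimal
`W`-value (hence `x ∉ 𝔪_S²`) with `W = (S[𝔪_S/x])_{centre}`; the chart characterization
`coe_eq_ordSet_of_chart_le` applies through the centre transfer
`mem_pow_succ_of_valuation_div_pow_lt_one`. [cite: ZariskiSamuel1960, App. 5] -/
theorem coe_eq_ordSet_of_isQuadraticTransformAlong_self (S : Subalgebra k K) [IsRegularLocalRing ↥S]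
    [IsFractionRing ↥S K] (W : ValuationSubring K) [IsDiscreteValuationRing ↥W]
    (hdom : SubringDominates S.toSubring W.toSubring)
    (hstep : IsQuadraticTransformAlong W S.toSubring W.toSubring) :
    (W : Set K) = ordSet S := by
  classical
  haveI := isDomain_of_isRegularLocalRing (↥S)
  obtain ⟨hloc, x, hx𝔪, hx0, hxmin, hWeq⟩ := hstep.exists_eq_locAtCentre
  -- the parameter `x`: positive `W`-value, not in `𝔪_S²`
  let xS : ↥S := ⟨(x : K), x.2⟩
  have hxK : (x : K) ≠ 0 := fun h => hx0 (Subtype.ext h)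
  have hxS𝔪 : xS ∈ maximalIdeal ↥S := hx𝔪
  have hxW : W.valuation (x : K) < 1 :=
    valuation_lt_one_of_subringDominates hdom x.2 fun hinv =>
      ((mem_maximalIdeal_iff_inv_not_mem x).mp hx𝔪).elim (fun h => hxK h) (fun h => h hinv)
  have hw0 : 0 < W.valuation (x : K) := (Valuation.pos_iff _).mpr hxK
  have hxS2 : xS ∉ maximalIdeal ↥S ^ 2 := by
    intro hmem
    have key : ∀ r : ↥S, r ∈ maximalIdeal ↥S ^ 2 →
        W.valuation (r : K) ≤ W.valuation (x : K) * W.valuation (x : K) := by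
      intro r hr
      rw [pow_two] at hr
      refine Submodule.mul_induction_on hr ?_ ?_
      · intro m hm m' hm'
        rw [Subalgebra.coe_mul, map_mul]
        exact mul_le_mul' (hxmin _ hm) (hxmin _ hm')
      · intro r₁ r₂ h₁ h₂
        rw [Subalgebra.coe_add]
        exact (Valuation.map_add _ _ _).trans (max_le h₁ h₂)
    have h1 := key xS hmem
    have h3 : W.valuation (x : K) * W.valuation (x : K) < W.valuation (x : K) :=
      mul_lt_of_lt_one_left hw0 hxW
    exact lt_irrefl _ (h1.trans_lt h3)
  -- the chart lies in `W`, and `W` is the localisation of the chart at its centre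
  have hBW : blowupRing S.toSubring (x : K) ≤ W.toSubring :=
    (le_locAtCentre (blowupRing S.toSubring (x : K)) W).trans hWeq.ge
  have hWB : W.toSubring ≤ locAtCentre (blowupRing S.toSubring (x : K)) W := hWeq.le
  have hchart : ∀ y : ↥S, y ∈ maximalIdeal ↥S → (y : K) / (x : K) ∈ W := fun y hy =>
    hBW (div_mem_blowupRing (x : K) (y := (⟨(y : K), y.2⟩ : ↥S.toSubring)) hy)
  have hcen := mem_pow_succ_of_valuation_div_pow_lt_one (S := S) W hxS𝔪 hxS2 hxW hBW hWB
  have hWtop : W ≠ ⊤ := by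
    intro h
    have hinv : ((x : K))⁻¹ ∈ W := by rw [h]; exact ValuationSubring.mem_top _
    have h1 := SyzygyFlattening.valuation_eq_one_of_inv_mem W (hdom.1 x.2) hinv hxK
    exact absurd h1 hxW.ne
  exact coe_eq_ordSet_of_chart_le W hWtop hdom.1 hxS𝔪 hxS2 hchart hcen

/-! ## (c) An exceptional prime divisor through a member of the quadratic sequence gives a base point -/

/-- A `k`-subalgebra of `K` (`tr.deg_k K = 2`) which is a domain has Krull dimension `≤ 2`. [folklore] -/
theorem ringKrullDim_le_two_of_trdeg (htr : Algebra.trdeg k K = 2) (B : Subalgebra k K) :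
    ringKrullDim ↥B ≤ 2 := by
  have htrB : Algebra.trdeg k ↥B ≤ Algebra.trdeg k K :=
    trdeg_le_of_injective B.val Subtype.val_injective
  rw [htr] at htrB
  have h := ringKrullDim_le_of_trdeg_le (k := k) (R := ↥B) (n := 2) (by exact_mod_cast htrB)
  exact_mod_cast h

/-- **Exceptional prime divisor ⇒ base point** (component (c) of the S2 plan).  Let `R` be regular
local of dimension two (`Frac R = K`, `tr.deg_k K = 2`), `O` a valuation ring dominating `R`,
`S_j` the quadratic sequence of `R` along `O`, and `T` a `k`-subalgebra with `T ≤ S_N`, `S_N`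
two-dimensional, `T ⊄ S_j` for `j < N`.  If a discrete valuation ring `W ⊇ S_N` of `K` dominates `R`
and `T` but NOT `S_N` (an exceptional prime divisor of `S_N` centred at the closed point of `T`), then
`T` has a base point over `R`: with `j₀` the last index at which `W` dominates `S_{j₀}`, the transform
of `S_{j₀}` along `W` is `W` (dimension count on the common chart), so `W = E_{S_{j₀}}` and
`S_{j₀} ∈ basePts R T`. [cite: ZariskiSamuel1960, App. 5] -/
theorem basePts_nonempty_of_exceptional_divisor {R : Subalgebra k K} [IsRegularLocalRing ↥R]
    [IsFractionRing ↥R K] (htr : Algebra.trdeg k K = 2) (hdimR : ringKrullDim ↥R = 2)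
    (O : ValuationSubring K) (hRO : SubringDominates R.toSubring O.toSubring)
    (T : Subalgebra k K) (N : ℕ) (hTN : T.toSubring ≤ quadraticSeq O R.toSubring N)
    (hTmin : ∀ j, j < N → ¬ T.toSubring ≤ quadraticSeq O R.toSubring j)
    (hN2 : (2 : WithBot ℕ∞) ≤ ringKrullDim ↥(quadraticSeq O R.toSubring N))
    (W : ValuationSubring K) [IsDiscreteValuationRing ↥W]
    (hNW : quadraticSeq O R.toSubring N ≤ W.toSubring)
    (hWR : SubringDominates R.toSubring W.toSubring)
    (hWT : ∀ t : K, t ∈ T → t⁻¹ ∈ W → t⁻¹ ∈ T)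
    (hWN : ¬ SubringDominates (quadraticSeq O R.toSubring N) W.toSubring) :
    (basePts R T).Nonempty := by
  classical
  haveI := isDomain_of_isRegularLocalRing (↥R)
  set seq : ℕ → Subring K := quadraticSeq O R.toSubring with hseq
  have hreg0 : IsRegularLocalRing ↥(seq 0) := ‹IsRegularLocalRing ↥R›
  haveI : IsLocalRing ↥(seq 0) := hreg0.toIsLocalRing
  have hnf : ¬ IsField ↥(seq 0) := fun hF => by
    have h := ringKrullDim_eq_zero_of_isField hF
    have h' : ringKrullDim ↥R = 0 := h
    rw [hdimR] at h'
    exact absurd h' (by norm_num)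
  have hstep : ∀ i, IsQuadraticTransformAlong O (seq i) (seq (i + 1)) := fun i =>
    RuledResiduesRegularModelRuled.isQuadraticTransformAlong_quadraticSeq_of_isRegularLocalRing
      hreg0 hnf hRO i
  have hmono : Monotone seq := sequence_monotone hstep
  have hregi : ∀ i, IsRegularLocalRing ↥(seq i) := isRegularLocalRing_sequence hreg0 hstep
  have hdomO : ∀ i, SubringDominates (seq i) O.toSubring := fun i => (sequence_dominates hRO hstep i).1
  have hof : ∀ i, ∀ z : K, ∃ a ∈ seq i, ∃ b ∈ seq i, b ≠ 0 ∧ z = a / b := by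
    intro i z
    obtain ⟨a, b, hb, rfl⟩ := IsFractionRing.div_surjective (A := ↥R) z
    have hbK : (b : K) ≠ 0 := fun h => nonZeroDivisors.ne_zero hb (by exact_mod_cast h)
    exact ⟨(a : K), hmono (Nat.zero_le i) a.2, (b : K), hmono (Nat.zero_le i) b.2, hbK, rfl⟩
  -- every member up to `N` is two-dimensional
  have hdim2 : ∀ i, i ≤ N → (2 : WithBot ℕ∞) ≤ ringKrullDim ↥(seq i) := by
    intro i hi
    haveI := hregi i
    refine RuledResiduesRegularModelRuled.two_le_ringKrullDim_of_not_le_one fun hle => ?_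
    have heq : seq i = O.toSubring :=
      RuledResiduesRegularModelRuled.eq_of_isRegularLocalRing_of_ringKrullDim_le_one (hregi i)
        hle (hof i) (hdomO i)
    have hNO : seq N = O.toSubring :=
      le_antisymm (hdomO N).1 (heq ▸ hmono hi)
    have h1 : ringKrullDim ↥(seq N) = ringKrullDim ↥(seq i) := by
      rw [ringKrullDim_eq_of_ringEquiv (RingEquiv.subringCongr hNO),
        ringKrullDim_eq_of_ringEquiv (RingEquiv.subringCongr heq)]
    have := hN2
    rw [h1] at this
    exact absurd (this.trans hle) (by decide)
  -- `j₀`: the last index `≤ N` at which `W` dominates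
  let P : ℕ → Prop := fun j => SubringDominates (seq j) W.toSubring
  have hP0 : P 0 := hWR
  set j₀ := Nat.findGreatest P N with hj₀
  have hPj₀ : P j₀ := Nat.findGreatest_spec (Nat.zero_le N) hP0
  have hj₀N : j₀ ≤ N := Nat.findGreatest_le N
  have hj₀lt : j₀ < N := by
    rcases hj₀N.lt_or_eq with h | h
    · exact h
    · exact absurd (h ▸ hPj₀) hWN
  have hPsucc : ¬ P (j₀ + 1) :=
    Nat.findGreatest_is_greatest (Nat.lt_succ_self j₀) (Nat.succ_le_of_lt hj₀lt)
  -- the `O`-step `S_{j₀} → S_{j₀+1}` and its chart `A`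
  set Sj : Subring K := seq j₀ with hSj
  set Sp : Subring K := seq (j₀ + 1) with hSp
  have hstepj : IsQuadraticTransformAlong O Sj Sp := hstep j₀
  obtain ⟨hlocj, hSjO, u, u₀, hu, hu₀, h0, hvalO, heq⟩ := hstepj
  set A : Subring K := Subring.closure ((Sj : Set K) ∪ (fun y : ↥Sj => (y : K) / (u₀ : K)) '' ↑u)
    with hA
  have hASp : A ≤ Sp := by rw [heq]; exact le_locAtCentre A O
  have hSpN : Sp ≤ seq N := hmono (Nat.succ_le_of_lt hj₀lt)
  have hSpW : Sp ≤ W.toSubring := hSpN.trans hNW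
  have hAW : A ≤ W.toSubring := hASp.trans hSpW
  have hAO : A ≤ O.toSubring := hASp.trans (hdomO (j₀ + 1)).1
  have hSjA : Sj ≤ A := fun z hz => Subring.subset_closure (Or.inl hz)
  have hSjW : Sj ≤ W.toSubring := hPj₀.1
  have hu₀K : ((u₀ : ↥Sj) : K) ≠ 0 := fun h => h0 (Subtype.ext h)
  have hw0 : 0 < W.valuation ((u₀ : ↥Sj) : K) := (Valuation.pos_iff _).mpr hu₀K
  -- `u₀` has minimal `W`-value among the generators (the chart lies in `W`)
  have hvalW : ∀ y ∈ u, W.valuation ((y : ↥Sj) : K) ≤ W.valuation ((u₀ : ↥Sj) : K) := by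
    intro y hy
    have hmem : ((y : ↥Sj) : K) / ((u₀ : ↥Sj) : K) ∈ W :=
      hAW (Subring.subset_closure (Or.inr ⟨y, hy, rfl⟩))
    have h1 : W.valuation (((y : ↥Sj) : K) / ((u₀ : ↥Sj) : K)) ≤ 1 :=
      (ValuationSubring.valuation_le_one_iff W _).mpr hmem
    rwa [map_div₀, div_le_one₀ hw0] at h1
  -- the transform `Q` of `S_{j₀}` along `W`, in the same chart
  set Q : Subring K := locAtCentre A W with hQ
  have hstepW : IsQuadraticTransformAlong W Sj Q := ⟨hlocj, hSjW, u, u₀, hu, hu₀, h0, hvalW, rfl⟩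
  have hQreg : IsRegularLocalRing ↥Q := hstepW.isRegularLocalRing_of_isRegularLocalRing (hregi j₀)
  have hQdom : SubringDominates Q W.toSubring := hstepW.dominated
  -- the two centres on `A`
  set 𝔮 : Ideal ↥A := subringCentre A W hAW with h𝔮
  set 𝔫 : Ideal ↥A := subringCentre A O hAO with h𝔫
  have hunitSp : ∀ b : K, b ∈ A → O.valuation b = 1 → W.valuation b = 1 := by
    intro b hb hob
    have hbinv : b⁻¹ ∈ Sp := by
      rw [heq]; exact inv_mem_locAtCentre (le_locAtCentre A O hb) hob
    exact SyzygyFlattening.valuation_eq_one_of_inv_mem W (hAW hb) (hSpW hbinv)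
      (ne_zero_of_valuation_eq_one hob)
  have h𝔮𝔫 : 𝔮 ≤ 𝔫 := by
    intro z hz
    rw [mem_subringCentre_iff] at hz ⊢
    by_contra hnot
    have hoz : O.valuation (z : K) = 1 :=
      le_antisymm ((ValuationSubring.valuation_le_one_iff O _).mpr (hAO z.2)) (not_lt.mp hnot)
    exact absurd (hunitSp z z.2 hoz) hz.ne
  have hne : 𝔮 ≠ 𝔫 := by
    intro h𝔮𝔫eq
    apply hPsucc
    -- `W` would dominate `S_{j₀+1} = locAtCentre A O`
    refine ⟨hSpW, fun s hs hsinv => ?_⟩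
    have hs' : s ∈ locAtCentre A O := by rw [← heq]; exact hs
    obtain ⟨a, ha, b, hb, hob, rfl⟩ := (mem_locAtCentre_iff).mp hs'
    by_cases ha0 : a = 0
    · subst ha0; rw [zero_div, inv_zero]; exact Sp.zero_mem
    have hwb : W.valuation b = 1 := hunitSp b hb hob
    have hb0 : b ≠ 0 := ne_zero_of_valuation_eq_one hob
    -- `w(a) = 1`: from `(a/b)⁻¹ ∈ W`
    have hwa : W.valuation a = 1 := by
      have hva0 : 0 < W.valuation a := (Valuation.pos_iff _).mpr ha0
      have h1 : W.valuation ((a / b)⁻¹) ≤ 1 := (ValuationSubring.valuation_le_one_iff W _).mpr hsinv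
      rw [inv_div, map_div₀, hwb, one_div, inv_le_one₀ hva0] at h1
      exact le_antisymm ((ValuationSubring.valuation_le_one_iff W _).mpr (hAW ha)) h1
    -- hence `a ∉ 𝔮 = 𝔫`, i.e. `o(a) = 1`
    have ha𝔫 : (⟨a, ha⟩ : ↥A) ∉ 𝔫 := by
      rw [← h𝔮𝔫eq, mem_subringCentre_iff]
      exact fun hlt => absurd hwa hlt.ne
    have hoa : O.valuation a = 1 := valuation_eq_one_of_not_mem_subringCentre hAO ha𝔫
    rw [inv_div]
    have hmem : b / a ∈ locAtCentre A O := ⟨b, hb, a, ha, hoa, rfl⟩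
    rw [← heq] at hmem
    exact hmem
  have hlt : 𝔮 < 𝔫 := lt_of_le_of_ne h𝔮𝔫 hne
  -- dimension count: `dim Q = ht 𝔮 < ht 𝔫 ≤ dim A ≤ 2`
  have hRA : R.toSubring ≤ A := (hmono (Nat.zero_le j₀)).trans hSjA
  let A' : Subalgebra k K :=
    { A.toSubsemiring with algebraMap_mem' := fun c => hRA (R.algebraMap_mem c) }
  have hdimA : ringKrullDim ↥A ≤ 2 := ringKrullDim_le_two_of_trdeg htr A'
  haveI := isLocalization_locAtCentre hAW
  have hdimQ : ringKrullDim ↥Q ≤ 1 := by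
    rw [IsLocalization.AtPrime.ringKrullDim_eq_height 𝔮 ↥Q]
    have h1 : 𝔮.height + 1 ≤ 𝔫.height := Ideal.height_add_one_le_of_lt_of_isPrime hlt
    have h2 : (𝔫.height : WithBot ℕ∞) ≤ ringKrullDim ↥A := Ideal.height_le_ringKrullDim_of_isPrime
    have h3 : (𝔫.height : WithBot ℕ∞) ≤ 2 := h2.trans hdimA
    have h4 : 𝔫.height ≤ 2 := by
      rw [show (2 : WithBot ℕ∞) = ((2 : ℕ∞) : WithBot ℕ∞) from rfl] at h3
      exact WithBot.coe_le_coe.mp h3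
    have h5 : 𝔮.height ≤ 1 := by
      have : 𝔮.height + 1 ≤ 2 := h1.trans h4
      -- `ℕ∞` arithmetic
      rcases ENat.ne_top_iff_exists.mp (show 𝔮.height ≠ ⊤ from by
        intro htop; rw [htop, top_add] at this; exact absurd this (by decide)) with ⟨m, hm⟩
      rw [← hm] at this ⊢
      have : m + 1 ≤ 2 := by exact_mod_cast this
      exact_mod_cast (show m ≤ 1 by omega)
    exact_mod_cast h5
  -- so `Q`, regular of dimension `≤ 1` and dominated by `W`, is `W`
  have hofQ : ∀ z : K, ∃ a ∈ Q, ∃ b ∈ Q, b ≠ 0 ∧ z = a / b := by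
    intro z
    obtain ⟨a, ha, b, hb, hb0, rfl⟩ := hof j₀ z
    exact ⟨a, le_locAtCentre A W (hSjA ha), b, le_locAtCentre A W (hSjA hb), hb0, rfl⟩
  have hQW : Q = W.toSubring :=
    RuledResiduesRegularModelRuled.eq_of_isRegularLocalRing_of_ringKrullDim_le_one hQreg hdimQ hofQ
      hQdom
  have hstepW' : IsQuadraticTransformAlong W Sj W.toSubring := hQW ▸ hstepW
  -- `S_{j₀}` as a `k`-subalgebra; `W = E_{S_{j₀}}`
  have hRSj : R.toSubring ≤ Sj := hmono (Nat.zero_le j₀)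
  let S : Subalgebra k K :=
    { Sj.toSubsemiring with algebraMap_mem' := fun c => hRSj (R.algebraMap_mem c) }
  have hRS : R ≤ S := fun z hz => hRSj hz
  have hregS : IsRegularLocalRing ↥S := hregi j₀
  haveI := hregS
  haveI : IsFractionRing ↥S K := isFractionRing_subalgebra_of_le R S hRS
  have hdomS : SubringDominates S.toSubring W.toSubring := hPj₀
  have hstepS : IsQuadraticTransformAlong W S.toSubring W.toSubring := hstepW'
  have hWS : (W : Set K) = ordSet S := coe_eq_ordSet_of_isQuadraticTransformAlong_self S W hdomS hstepS
  -- `S ∈ basePts R T`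
  refine ⟨S, hRS, hregS, ?_, ?_, ?_⟩
  · -- dimension two
    exact le_antisymm (ringKrullDim_le_two_of_trdeg htr S) (hdim2 j₀ hj₀N)
  · -- `T ⊄ S_{j₀}`
    intro hTS
    exact hTmin j₀ hj₀lt (fun z hz => hTS hz)
  · -- `E_{S_{j₀}} = W` dominates `T`
    rw [← hWS]
    intro t ht
    exact ⟨hNW (hTN ht), fun hinv => hWT t ht hinv⟩

end Summit.ResolutionOfSingularities.ResolutionOfSingularities.Theorems.NoZeno.SandwichCluster

end
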